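import Summits.AtomisticToContinuum.HydrodynamicLimit.Theorems.StiffCollisionalRelaxationAprioriBoundsMesoPartTwoGrid
import Summits.AtomisticToContinuum.HydrodynamicLimit.Theorems.StiffCollisionalRelaxationAprioriBoundsFibreDefsR4
import Literature.MathematicalPhysics.KineticTheory.HardSphereTwoTimePressure
import Mathlib.Analysis.SpecialFunctions.Pow.Asymptotics
import HarnessLib

/-!
# Stub `stub_partTwo_of_meanVariance` of the line `meso-chebyshev-window` (crux `AprioriBounds`,
stmt-AtomisticToContinuum-14827): the mesoscopic Chebyshev window

Component (ii) of the crux — no vacuum / no jam of the kernel block density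
`ρ̄(s, x)(z) = (N+1)⁻¹ ∑ᵢ φ_N(qᵢ(s) − x)` UNIFORMLY over `(s, x) ∈ [0, t] × 𝕋³`, with high probability under
the local Gibbs law — from three per-point inputs: a FLOOR `m ≤ E ρ̄(s, x)` and a CEILING
`E ρ̄(s, x) σ³ ≤ κ < 1` in the mean, and a Poisson-order VARIANCE `Var ρ̄(s, x) ≤ A (N+1)^{3γ−1}`.

Proof (all constants explicit): `c₁ := m/2`, `δ := min (m/8) ((1 − κ)/(4σ³))`.  On good orbits with energy
per sphere `≤ E₀` the block density is Lipschitz in time with `L_s = √3 C (N+1)^{4γ} √(2 max(E₀,0))`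
(`abs_density_flow_sub_le`) and in the centre with `L_x = (N+1)⁻¹ · 2(2h/ε + 1)³ · √3 C (N+1)^{4γ}
≤ 54√3 C σ⁻³ (N+1)^{γ}` (`abs_density_sub_le_norm_centre`, hard-core packing); a grid of
`O((N+1)^{4γ}) × O((N+1)^{3γ})` points of `[0, t] × 𝕋³` resolves `δ`; Chebyshev at each grid point and the
union bound (`measure_badEvent_le`) cost `O((N+1)^{7γ}) · A(N+1)^{3γ−1}/δ² = O((N+1)^{10γ−1}) → 0` because
`γ ≤ 1/15 < 1/10` (`budget_le`, `tendsto_rpow_window`); the bad set is null and the energy event is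
negligible by hypothesis.
-/

noncomputable section

open MeasureTheory ProbabilityTheory Filter Set Topology
open scoped ENNReal

namespace Summit.AtomisticToContinuum.HydrodynamicLimit.Theorems.MesoChebyshevWindow

open Literature.MathematicalPhysics.KineticTheory Literature.Analysis.FluidPDE
open Summit.AtomisticToContinuum.HydrodynamicLimit.Theorems.AprioriBoundsNegative (PartOneAt PartTwoAt)
open Summit.AtomisticToContinuum.HydrodynamicLimit.Theorems.VisitLedgerUpscattering (Cfg Flow Flows NiceProfiles)
open Summit.AtomisticToContinuum.HydrodynamicLimit.Theorems.FibreDeficitTransfer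

/-! ## Exponent bookkeeping -/

/-- The powers of `ν = N + 1` in play, in terms of `u = ν^γ` (`0 ≤ γ`, `3γ ≤ 1`, `1 ≤ ν`). -/
theorem scales_rpow {ν γ : ℝ} (hν : 1 ≤ ν) (hγ : 0 ≤ γ) (hγ3 : 3 * γ ≤ 1) :
    1 ≤ ν ^ γ ∧ ν ^ (3 * γ) = (ν ^ γ) ^ 3 ∧ ν ^ (4 * γ) = (ν ^ γ) ^ 4 ∧ ν ^ (-γ) = (ν ^ γ)⁻¹ ∧
      ν ^ (3 * γ - 1) = (ν ^ γ) ^ 3 * ν⁻¹ ∧ (ν ^ γ) ^ 3 ≤ ν ∧ ν ^ (-(1 / 3 : ℝ)) ≤ ν ^ (-γ) ∧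
      (ν ^ γ) ^ 10 * ν⁻¹ = ν ^ (10 * γ - 1) := by
  have hν0 : 0 < ν := one_pos.trans_le hν
  have hpow : ∀ k : ℕ, ν ^ ((k : ℝ) * γ) = (ν ^ γ) ^ k := fun k => by
    rw [mul_comm, Real.rpow_mul hν0.le, Real.rpow_natCast]
  have h3 : ν ^ (3 * γ) = (ν ^ γ) ^ 3 := by exact_mod_cast hpow 3
  have h4 : ν ^ (4 * γ) = (ν ^ γ) ^ 4 := by exact_mod_cast hpow 4
  have h10 : ν ^ (10 * γ) = (ν ^ γ) ^ 10 := by exact_mod_cast hpow 10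
  refine ⟨Real.one_le_rpow hν hγ, h3, h4, Real.rpow_neg hν0.le γ, ?_, ?_, ?_, ?_⟩
  · rw [Real.rpow_sub_one hν0.ne', h3, div_eq_mul_inv]
  · rw [← h3]
    calc ν ^ (3 * γ) ≤ ν ^ (1 : ℝ) := Real.rpow_le_rpow_of_exponent_le hν hγ3
      _ = ν := Real.rpow_one ν
  · exact Real.rpow_le_rpow_of_exponent_le hν (by linarith)
  · rw [Real.rpow_sub_one hν0.ne', h10, div_eq_mul_inv]

/-- `(N + 1)^{10γ − 1} → 0` for `10γ < 1`. -/
theorem tendsto_rpow_window {γ : ℝ} (h : 10 * γ - 1 < 0) :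
    Tendsto (fun N : ℕ => ((N : ℝ) + 1) ^ (10 * γ - 1)) atTop (𝓝 0) := by
  have h1 : Tendsto (fun N : ℕ => (N : ℝ) + 1) atTop atTop :=
    tendsto_atTop_add_const_right _ 1 tendsto_natCast_atTop_atTop
  have h2 := (tendsto_rpow_neg_atTop (y := 1 - 10 * γ) (by linarith)).comp h1
  refine h2.congr fun N => ?_
  simp only [Function.comp_apply]
  congr 1
  ring

/-- Rounding up: `a < (⌈a/δ⌉ + 1) δ`. -/
theorem lt_ceil_add_one_mul (a : ℝ) {δ : ℝ} (hδ : 0 < δ) : a < ((⌈a / δ⌉₊ + 1 : ℕ) : ℝ) * δ := by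
  have h := Nat.le_ceil (a / δ)
  rw [div_le_iff₀ hδ] at h
  push_cast
  linarith

/-- Rounding up: `⌈a/δ⌉ + 1 ≤ a/δ + 2` for `0 ≤ a`. -/
theorem ceil_add_one_le {a δ : ℝ} (ha : 0 ≤ a) (hδ : 0 < δ) : ((⌈a / δ⌉₊ + 1 : ℕ) : ℝ) ≤ a / δ + 2 := by
  have h := Nat.ceil_lt_add_one (div_nonneg ha hδ.le)
  push_cast
  linarith

/-- **The polynomial budget.**  With `u = (N+1)^γ ≥ 1`, `u³ ≤ ν = N + 1`, `ν ε³ = σ³`, `ε ≤ σ u⁻¹`,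
`L_s = √3 C u⁴ √(2E)`, `L_x = ν⁻¹ · 2(2u⁻¹/ε + 1)³ · √3 C u⁴`, grid counts `M ≤ t L_s/δ + 2`,
`n ≤ L_x/δ + 2` and per-point Chebyshev bound `A u³ ν⁻¹/δ²`:
`(M + 1) n³ · A u³ν⁻¹/δ² ≤ K · u¹⁰ ν⁻¹` with `K = (t √3 C √(2E)/δ + 3)(54√3 C σ⁻³/δ + 2)³ A/δ²`
(the packing count `(2u⁻¹/ε + 1)³ ≤ 27 ν/(σ³u³)` is where `L_x = O(u)` comes from). -/
theorem budget_le {ν u σ C E δ t ε Ls Lx A : ℝ} {M n : ℕ} (hu : 1 ≤ u) (hu3 : u ^ 3 ≤ ν)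
    (hσ : 0 < σ) (hσ1 : σ ≤ 1) (hC : 0 ≤ C) (hδ : 0 < δ) (ht : 0 < t) (hA : 0 ≤ A)
    (hε : 0 < ε) (hε3 : ν * ε ^ 3 = σ ^ 3) (hεh : ε ≤ σ * u⁻¹)
    (hLs : Ls = Real.sqrt 3 * (C * u ^ 4) * Real.sqrt (2 * E))
    (hLx : Lx = ν⁻¹ * (2 * (2 * u⁻¹ / ε + 1) ^ 3 * (Real.sqrt 3 * (C * u ^ 4))))
    (hM : (M : ℝ) ≤ t * Ls / δ + 2) (hn : (n : ℝ) ≤ Lx / δ + 2) :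
    ((M : ℝ) + 1) * (n : ℝ) ^ 3 * (A * (u ^ 3 * ν⁻¹) / δ ^ 2) ≤
      (t * (Real.sqrt 3 * C * Real.sqrt (2 * E)) / δ + 3) * (54 * Real.sqrt 3 * C / σ ^ 3 / δ + 2) ^ 3 *
        (A / δ ^ 2) * (u ^ 10 * ν⁻¹) := by
  have hu0 : 0 < u := one_pos.trans_le hu
  have hν : 0 < ν := lt_of_lt_of_le (by positivity) hu3
  have hh0 : 0 < u⁻¹ := inv_pos.2 hu0
  -- the packing count
  have hq : 1 ≤ u⁻¹ / ε := by
    rw [le_div_iff₀ hε, one_mul]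
    exact hεh.trans (mul_le_of_le_one_left hh0.le hσ1)
  have hcube : (2 * u⁻¹ / ε + 1) ^ 3 ≤ 27 * (ν / (σ ^ 3 * u ^ 3)) := by
    have h1 : 2 * u⁻¹ / ε + 1 ≤ 3 * (u⁻¹ / ε) := by rw [mul_div_assoc]; linarith
    have h2 : (u⁻¹ / ε) ^ 3 = ν / (σ ^ 3 * u ^ 3) := by
      have hε3' : ε ^ 3 = σ ^ 3 / ν := by rw [← hε3]; field_simp
      rw [div_pow, inv_pow, hε3']
      field_simp
    calc (2 * u⁻¹ / ε + 1) ^ 3 ≤ (3 * (u⁻¹ / ε)) ^ 3 := pow_le_pow_left₀ (by positivity) h1 3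
      _ = 27 * (ν / (σ ^ 3 * u ^ 3)) := by rw [mul_pow, h2]; norm_num
  have hLx' : Lx ≤ 54 * Real.sqrt 3 * C / σ ^ 3 * u := by
    rw [hLx]
    calc ν⁻¹ * (2 * (2 * u⁻¹ / ε + 1) ^ 3 * (Real.sqrt 3 * (C * u ^ 4)))
        ≤ ν⁻¹ * (2 * (27 * (ν / (σ ^ 3 * u ^ 3))) * (Real.sqrt 3 * (C * u ^ 4))) := by gcongr
      _ = 54 * Real.sqrt 3 * C / σ ^ 3 * u := by field_simp; ring
  -- the two counts
  have hM' : (M : ℝ) + 1 ≤ (t * (Real.sqrt 3 * C * Real.sqrt (2 * E)) / δ + 3) * u ^ 4 := by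
    have hu4 : 1 ≤ u ^ 4 := one_le_pow₀ hu
    have hc : 0 ≤ t * (Real.sqrt 3 * C * Real.sqrt (2 * E)) / δ := by positivity
    calc (M : ℝ) + 1 ≤ t * Ls / δ + 3 := by linarith
      _ = t * (Real.sqrt 3 * C * Real.sqrt (2 * E)) / δ * u ^ 4 + 3 := by rw [hLs]; ring
      _ ≤ t * (Real.sqrt 3 * C * Real.sqrt (2 * E)) / δ * u ^ 4 + 3 * u ^ 4 := by linarith
      _ = (t * (Real.sqrt 3 * C * Real.sqrt (2 * E)) / δ + 3) * u ^ 4 := by ring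
  have hn' : (n : ℝ) ≤ (54 * Real.sqrt 3 * C / σ ^ 3 / δ + 2) * u := by
    calc (n : ℝ) ≤ Lx / δ + 2 := hn
      _ ≤ 54 * Real.sqrt 3 * C / σ ^ 3 * u / δ + 2 := by gcongr
      _ ≤ 54 * Real.sqrt 3 * C / σ ^ 3 * u / δ + 2 * u := by linarith
      _ = (54 * Real.sqrt 3 * C / σ ^ 3 / δ + 2) * u := by ring
  -- multiply
  have hprod : ((M : ℝ) + 1) * (n : ℝ) ^ 3 ≤
      ((t * (Real.sqrt 3 * C * Real.sqrt (2 * E)) / δ + 3) * u ^ 4) *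
        ((54 * Real.sqrt 3 * C / σ ^ 3 / δ + 2) * u) ^ 3 :=
    mul_le_mul hM' (pow_le_pow_left₀ (Nat.cast_nonneg _) hn' 3) (by positivity) (by positivity)
  calc ((M : ℝ) + 1) * (n : ℝ) ^ 3 * (A * (u ^ 3 * ν⁻¹) / δ ^ 2)
      ≤ ((t * (Real.sqrt 3 * C * Real.sqrt (2 * E)) / δ + 3) * u ^ 4) *
          ((54 * Real.sqrt 3 * C / σ ^ 3 / δ + 2) * u) ^ 3 * (A * (u ^ 3 * ν⁻¹) / δ ^ 2) :=
        mul_le_mul_of_nonneg_right hprod (by positivity)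
    _ = _ := by ring

/-! ## The stub -/

/-- **STUB 4 `partTwo_of_meanVariance` of the line `meso-chebyshev-window` (the mesoscopic Chebyshev
window).**  For `0 < σ ≤ 1/2`, nice profiles, `t > 0`, any flow family and a negligible bounded-energy
event at time `0`: for every admissible kernel family at scale `(N+1)^{-γ}`, `γ ≤ 1/15`, a floor
`m ≤ E ρ̄` and a ceiling `E ρ̄ σ³ ≤ κ < 1` in the mean and a Poisson-order variance
`Var ρ̄ ≤ A(N+1)^{3γ−1}`, uniformly on `[0, t] × 𝕋³` eventually in `N`, imply component (ii) of the crux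
with `c₁ = m/2`: `P_N{∃ s ∈ [0,t], ∃ x, ρ̄(s,x) < c₁ ∨ 1 < ρ̄(s,x)σ³} → 0`. -/
theorem stub_partTwo_of_meanVariance :
    ∀ (σ : ℝ) (a₀ θ₀ : T3 → ℝ) (u₀ : T3 → V3)
      (Φ : (N : ℕ) → HardSphereFlow (Torus.geometry (Fin 3)) (hsDiameter σ N) (N + 1)) (t : ℝ),
      0 < σ → σ ≤ 1 / 2 → NiceProfiles a₀ θ₀ u₀ → 0 < t →
      (∃ E₀ : ℝ, Tendsto (fun N : ℕ => localGibbsLaw σ a₀ u₀ θ₀ N (Φ N)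
          {z | E₀ < empiricalEnergyField ((Φ N).flow 0 z) (fun _ => 1)}) atTop (𝓝 0)) →
      ∀ (γ C : ℝ) (φ : ℕ → T3 → ℝ), 0 < γ → γ ≤ 1 / 15 →
        ((∀ N, Literature.Analysis.FunctionSpaces.Torus.IsSmooth (φ N)) ∧ (∀ N y, 0 ≤ φ N y) ∧
          (∀ N, ∫ y, φ N y = 1) ∧
          (∀ (N : ℕ) y, ((N : ℝ) + 1) ^ (-γ) ≤ Torus.euclidDist y 0 → φ N y = 0) ∧
          (∀ (N : ℕ) y, φ N y ≤ C * ((N : ℝ) + 1) ^ (3 * γ)) ∧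
          (∀ (N : ℕ) y, ‖Literature.Analysis.FunctionSpaces.Torus.gradient (φ N) y‖ ≤
            C * ((N : ℝ) + 1) ^ (4 * γ))) →
        (∃ m : ℝ, 0 < m ∧ ∃ N₀ : ℕ, ∀ N : ℕ, N₀ ≤ N → ∀ s ∈ Icc 0 t, ∀ x : T3,
          m ≤ ∫ z, empiricalDensityField ((Φ N).flow s z) (fun y => φ N (y - x))
            ∂(localGibbsLaw σ a₀ u₀ θ₀ N (Φ N))) →
        (∃ κ : ℝ, κ < 1 ∧ ∃ N₀ : ℕ, ∀ N : ℕ, N₀ ≤ N → ∀ s ∈ Icc 0 t, ∀ x : T3,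
          (∫ z, empiricalDensityField ((Φ N).flow s z) (fun y => φ N (y - x))
            ∂(localGibbsLaw σ a₀ u₀ θ₀ N (Φ N))) * σ ^ 3 ≤ κ) →
        (∃ A : ℝ, ∃ N₀ : ℕ, ∀ N : ℕ, N₀ ≤ N → ∀ s ∈ Icc 0 t, ∀ x : T3,
          MemLp (fun z => empiricalDensityField ((Φ N).flow s z) (fun y => φ N (y - x))) 2
              (localGibbsLaw σ a₀ u₀ θ₀ N (Φ N)) ∧
            variance (fun z => empiricalDensityField ((Φ N).flow s z) (fun y => φ N (y - x)))
              (localGibbsLaw σ a₀ u₀ θ₀ N (Φ N)) ≤ A * ((N : ℝ) + 1) ^ (3 * γ - 1)) →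
        ∃ c₁ : ℝ, 0 < c₁ ∧ Tendsto (fun N : ℕ => localGibbsLaw σ a₀ u₀ θ₀ N (Φ N)
          {z | ∃ s ∈ Icc 0 t, ∃ x : T3,
            empiricalDensityField ((Φ N).flow s z) (fun y => φ N (y - x)) < c₁ ∨
              1 < empiricalDensityField ((Φ N).flow s z) (fun y => φ N (y - x)) * σ ^ 3}) atTop (𝓝 0) := by
  intro σ a₀ θ₀ u₀ Φ t hσ hσ2 hnice ht hEn γ C φ hγ hγ15 hker hfl hce hva
  obtain ⟨E₀, hE⟩ := hEn
  obtain ⟨hsm, hnn, -, hsupp, hCmax, hgrad⟩ := hker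
  obtain ⟨m, hm, N₁, hfloor⟩ := hfl
  obtain ⟨κ, hκ, N₂, hceil⟩ := hce
  obtain ⟨A, N₃, hvar⟩ := hva
  obtain ⟨ha, hθ, hu, ha0, hθ0⟩ := hnice
  have hprob : ∀ N, IsProbabilityMeasure (localGibbsLaw σ a₀ u₀ θ₀ N (Φ N)) := fun N =>
    isProbabilityMeasure_localGibbsLaw ha hθ hu ha0 hθ0 hσ2 N (Φ N)
  have hgood : ∀ N, localGibbsLaw σ a₀ u₀ θ₀ N (Φ N) (Φ N).goodᶜ = 0 := fun N =>
    ae_iff.1 (ae_mem_good_localGibbsLaw σ a₀ u₀ θ₀ N (Φ N))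
  -- constants
  have hσ3 : 0 < σ ^ 3 := by positivity
  have hσ1 : σ ≤ 1 := by linarith
  have hC : 0 ≤ C := by
    have h := (hnn 0 0).trans (hCmax 0 0)
    simp only [Nat.cast_zero, zero_add, Real.one_rpow, mul_one] at h
    exact h
  set δ : ℝ := min (m / 8) ((1 - κ) / (4 * σ ^ 3)) with hδdef
  have hδ : 0 < δ := lt_min (by positivity) (div_pos (by linarith) (by positivity))
  have hδ1 : 3 * δ < m / 2 := by
    have := min_le_left (m / 8) ((1 - κ) / (4 * σ ^ 3))
    linarith
  have hδ2 : κ + 3 * δ * σ ^ 3 ≤ 1 := by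
    have h1 : δ ≤ (1 - κ) / (4 * σ ^ 3) := min_le_right _ _
    rw [le_div_iff₀ (by positivity)] at h1
    have h2 : 0 ≤ δ * σ ^ 3 := by positivity
    linarith
  set Ē : ℝ := max E₀ 0 with hĒdef
  set A' : ℝ := max A 0 with hA'def
  have hA'0 : 0 ≤ A' := le_max_right _ _
  set K : ℝ := (t * (Real.sqrt 3 * C * Real.sqrt (2 * Ē)) / δ + 3) *
    (54 * Real.sqrt 3 * C / σ ^ 3 / δ + 2) ^ 3 * (A' / δ ^ 2) with hKdef
  -- the scale `u = (N+1)^γ → ∞`: beyond `N₄` the packing hypothesis `h + ε/2 < 1/2` holds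
  have hνt : Tendsto (fun N : ℕ => (N : ℝ) + 1) atTop atTop :=
    tendsto_atTop_add_const_right _ 1 tendsto_natCast_atTop_atTop
  obtain ⟨N₄, hN₄⟩ := eventually_atTop.1 (((tendsto_rpow_atTop hγ).comp hνt).eventually_ge_atTop 3)
  -- the bound at every large `N`
  have hbound : ∀ N : ℕ, max (max N₁ N₂) (max N₃ N₄) ≤ N →
      localGibbsLaw σ a₀ u₀ θ₀ N (Φ N) {z | ∃ s ∈ Icc 0 t, ∃ x : T3,
          empiricalDensityField ((Φ N).flow s z) (fun y => φ N (y - x)) < m / 2 ∨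
            1 < empiricalDensityField ((Φ N).flow s z) (fun y => φ N (y - x)) * σ ^ 3} ≤
        localGibbsLaw σ a₀ u₀ θ₀ N (Φ N) {z | E₀ < empiricalEnergyField ((Φ N).flow 0 z) (fun _ => 1)} +
          ENNReal.ofReal (K * ((N : ℝ) + 1) ^ (10 * γ - 1)) := by
    intro N hN
    have hN₁ : N₁ ≤ N := le_trans ((le_max_left _ _).trans (le_max_left _ _)) hN
    have hN₂ : N₂ ≤ N := le_trans ((le_max_right _ _).trans (le_max_left _ _)) hN
    have hN₃ : N₃ ≤ N := le_trans ((le_max_left _ _).trans (le_max_right _ _)) hN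
    have hN₄' : N₄ ≤ N := le_trans ((le_max_right _ _).trans (le_max_right _ _)) hN
    haveI := hprob N
    -- specialise the data at `N`, then abstract `ν = N + 1`, `u = ν^γ`
    have hgradN := hgrad N
    have hsuppN := hsupp N
    have hvarN := hvar N hN₃
    have hu3' := hN₄ N hN₄'
    simp only [Function.comp_apply] at hu3'
    set ν : ℝ := (N : ℝ) + 1 with hνdef
    have hν1 : 1 ≤ ν := by
      rw [hνdef]
      have := (Nat.cast_nonneg N : (0 : ℝ) ≤ N)
      linarith
    have hν0 : 0 < ν := one_pos.trans_le hν1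
    have hνcast : ((N + 1 : ℕ) : ℝ) = ν := by rw [hνdef]; exact Nat.cast_succ N
    obtain ⟨hu1, -, h4γ, hmγ, h3γ1, hu3, h13, h10⟩ := scales_rpow hν1 hγ.le (by linarith)
    set u : ℝ := ν ^ γ with hudef
    have hu0 : 0 < u := one_pos.trans_le hu1
    simp only [h4γ] at hgradN
    simp only [hmγ] at hsuppN
    simp only [h3γ1] at hvarN
    -- the diameter
    have hεpos : 0 < hsDiameter σ N := hsDiameter_pos hσ N
    have hε3 : ν * hsDiameter σ N ^ 3 = σ ^ 3 := by
      rw [← hνcast]; exact succ_mul_hsDiameter_pow_three σ N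
    have hεh : hsDiameter σ N ≤ σ * u⁻¹ := by
      rw [← hmγ]
      show σ * ((N + 1 : ℕ) : ℝ) ^ (-(1 / 3 : ℝ)) ≤ σ * ν ^ (-γ)
      rw [hνcast]
      exact mul_le_mul_of_nonneg_left h13 hσ.le
    have hhalf : u⁻¹ + hsDiameter σ N / 2 < 1 / 2 := by
      have hw : u⁻¹ ≤ 3⁻¹ := inv_anti₀ (by norm_num) hu3'
      have hε2 : hsDiameter σ N ≤ (1 / 2) * u⁻¹ :=
        hεh.trans (mul_le_mul_of_nonneg_right hσ2 (inv_nonneg.2 hu0.le))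
      linarith
    -- the moduli at `N`
    have hLsN : ∀ z ∈ (Φ N).good, empiricalEnergyField ((Φ N).flow 0 z) (fun _ => 1) ≤ E₀ →
        ∀ (s s' : ℝ) (x : T3),
        |empiricalDensityField ((Φ N).flow s' z) (fun y => φ N (y - x)) -
            empiricalDensityField ((Φ N).flow s z) (fun y => φ N (y - x))| ≤
          Real.sqrt 3 * (C * u ^ 4) * Real.sqrt (2 * Ē) * |s' - s| := by
      intro z hz hen s s' x
      have hEz : configEnergy z ≤ ((N + 1 : ℕ) : ℝ) * Ē := by
        have hen' := hen
        rw [(Φ N).flow_zero z hz] at hen'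
        rw [configEnergy_eq_succ_mul_empiricalEnergyField]
        exact mul_le_mul_of_nonneg_left (hen'.trans (le_max_left _ _)) (Nat.cast_nonneg _)
      exact abs_density_flow_sub_le (Φ N) hz (hsm N) hgradN hEz s s' x
    have hLxN : ∀ z ∈ (Φ N).good, ∀ (s : ℝ) (x x' : T3),
        |empiricalDensityField ((Φ N).flow s z) (fun y => φ N (y - x)) -
            empiricalDensityField ((Φ N).flow s z) (fun y => φ N (y - x'))| ≤
          ν⁻¹ * (2 * (2 * u⁻¹ / hsDiameter σ N + 1) ^ 3 * (Real.sqrt 3 * (C * u ^ 4))) * ‖x - x'‖ := by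
      intro z hz s x x'
      have hw := (Φ N).good_subset ((Φ N).mapsTo_good s hz)
      have h := abs_density_sub_le_norm_centre hw (hsm N) hgradN hsuppN hεpos (inv_nonneg.2 hu0.le)
        hhalf x x'
      rw [hνcast] at h
      exact h
    have hLs0 : 0 ≤ Real.sqrt 3 * (C * u ^ 4) * Real.sqrt (2 * Ē) := by positivity
    have hLx0 : 0 ≤ ν⁻¹ * (2 * (2 * u⁻¹ / hsDiameter σ N + 1) ^ 3 * (Real.sqrt 3 * (C * u ^ 4))) := by
      positivity
    -- the variance bound with `A' ≥ 0`
    have hvarN' : ∀ s ∈ Icc 0 t, ∀ x : T3,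
        MemLp (fun z => empiricalDensityField ((Φ N).flow s z) (fun y => φ N (y - x))) 2
            (localGibbsLaw σ a₀ u₀ θ₀ N (Φ N)) ∧
          variance (fun z => empiricalDensityField ((Φ N).flow s z) (fun y => φ N (y - x)))
            (localGibbsLaw σ a₀ u₀ θ₀ N (Φ N)) ≤ A' * (u ^ 3 * ν⁻¹) := by
      intro s hs x
      have h := hvarN s hs x
      exact ⟨h.1, h.2.trans (mul_le_mul_of_nonneg_right (le_max_left _ _)
        (mul_nonneg (pow_nonneg hu0.le 3) (inv_nonneg.2 hν0.le)))⟩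
    -- the window at `N`
    have hmain := measure_badEvent_le (Φ N) (localGibbsLaw σ a₀ u₀ θ₀ N (Φ N)) (hgood N) (φ N)
      (E₀ := E₀) hLsN hLxN hLs0 hLx0 ht hδ (lt_ceil_add_one_mul _ hδ) (lt_ceil_add_one_mul _ hδ)
      (hfloor N hN₁) (hceil N hN₂) hvarN' hδ1 hσ3.le hδ2
    have hbud := budget_le (t := t) (A := A') (E := Ē) hu1 hu3 hσ hσ1 hC hδ ht hA'0 hεpos hε3 hεh rfl rfl
      (ceil_add_one_le (by positivity) hδ) (ceil_add_one_le hLx0 hδ)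
    rw [h10] at hbud
    exact hmain.trans (add_le_add le_rfl (ENNReal.ofReal_le_ofReal hbud))
  -- the limit
  refine ⟨m / 2, by positivity, ?_⟩
  have hlim : Tendsto (fun N : ℕ =>
      localGibbsLaw σ a₀ u₀ θ₀ N (Φ N) {z | E₀ < empiricalEnergyField ((Φ N).flow 0 z) (fun _ => 1)} +
        ENNReal.ofReal (K * ((N : ℝ) + 1) ^ (10 * γ - 1))) atTop (𝓝 0) := by
    have h1 : Tendsto (fun N : ℕ => ENNReal.ofReal (K * ((N : ℝ) + 1) ^ (10 * γ - 1))) atTop (𝓝 0) := by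
      have h := (tendsto_rpow_window (γ := γ) (by linarith)).const_mul K
      rw [mul_zero] at h
      have h' := ENNReal.tendsto_ofReal h
      rwa [ENNReal.ofReal_zero] at h'
    simpa only [add_zero] using hE.add h1
  refine tendsto_of_tendsto_of_tendsto_of_le_of_le' tendsto_const_nhds hlim
    (Eventually.of_forall fun _ => zero_le) ?_
  exact eventually_atTop.2 ⟨max (max N₁ N₂) (max N₃ N₄), hbound⟩

end Summit.AtomisticToContinuum.HydrodynamicLimit.Theorems.MesoChebyshevWindow

end
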